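import Mathlib.NumberTheory.Zsqrtd.GaussianInt
import Mathlib.NumberTheory.Zsqrtd.QuadraticReciprocity
import Mathlib.RingTheory.Localization.FractionRing
import Mathlib.RingTheory.PrincipalIdealDomain
import Mathlib.Tactic.NormNum.Prime
import Literature.Barriers.BirchSwinnertonDyer.RankNotSumOfLocalInvariantsF4Field
import HarnessLib

/-!
# `rk E(F₄)` for `E = 480a1` via `ℚ(√-1)`, I: the Gaussian integers inside `K1 = ℚ(√-1)`

Arithmetic groundwork for the complete `2`-descents over `K1 = ℚ(√-1)`
(`DokchitserDokchitser2011.K1`, the tree's model `QuadraticAlgebra ℚ (-1) 0`) of the quadratic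
twists `E^{(d)} : y² = x(x + 2d)(x - 3d)`, `d ∈ {1, 41, 73, 2993}`, of `E = 480a1`, by which the
descent leaf `rk E(F₄) = 6` of T. Dokchitser–V. Dokchitser, *A note on the Mordell–Weil rank
modulo `n`* (J. Number Theory 131 (2011); arXiv:0910.4588), proof of Thm. 2 ("2-descent […]
over all minimal non-trivial subfields of `F₄`"; `ℚ(√-1) ⊂ F₄ = ℚ(√-1, √41, √73)` is one of
them, and `rk E(F₄) = Σ_{d} rk E^{(d)}(ℚ(√-1))`, tree `mordellWeilRank_F4_eq`) is proved in the
sequel files. Everything here is PROVED (theorems and definitions with bodies only):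

* `toK1 : ℤ[i] →+* K1`, the inclusion of Mathlib's Gaussian integers `GaussianInt = ℤ√-1`
  (a Euclidean domain in Mathlib, hence a PID and a UFD) into `K1`, coordinatewise
  (`toK1_re`, `toK1_im`), injective; `K1` is the fraction field of `ℤ[i]`
  (`instIsFractionRingGaussianIntK1`), and every element of `K1` is `toK1 z / N` with `N ≥ 1`
  a natural number (`K1.exists_nat_mul_eq_toK1`).
* The prime elements of `ℤ[i]` at which the descents ramify: `gI = i` (the unit), and
  `g2 = 1 + i`, `3`, `g5a = 2 + i`, `g5b = 2 - i`, `g41a = 5 + 4i`, `g41b = 5 - 4i`,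
  `g73a = 8 + 3i`, `g73b = 8 - 3i` — primes because their norms `2, 5, 5, 41, 41, 73, 73` are
  rational primes (`prime_of_prime_natAbs_norm`) resp. `3 ≡ 3 (mod 4)` (Mathlib); the
  factorisation `2·3·5·41·73 = -(i (1+i)²) · 3 · (2+i)(2-i) · (5+4i)(5-4i) · (8+3i)(8-3i)`
  (`D_eq`) and its consequence: a prime of `ℤ[i]` dividing `D = 89790` is associated to one of
  the eight (`associated_of_prime_of_dvd_D`).
* The units of `ℤ[i]` are `±1, ±i`, so every unit is `i^a · w²` with `a ∈ {0, 1}`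
  (`exists_eq_gI_pow_mul_sq_of_isUnit`).

## References

* T. Dokchitser, V. Dokchitser, *A note on the Mordell–Weil rank modulo `n`*, J. Number Theory
  131 (2011) 1833–1839, arXiv:0910.4588, proof of Thm. 2. [DokchitserDokchitser2011RankModN]
* J. H. Silverman, *The Arithmetic of Elliptic Curves*, 2nd ed., GTM 106 (2009), Ch. X §1
  (complete `2`-descent; the group `K(S, 2)`). [SilvermanAEC2009]
-/

namespace Literature.Barriers.BirchSwinnertonDyer.DokchitserDokchitser2011

open QuadraticAlgebra

/-- Mathlib's Gaussian integers `ℤ√-1` (the notation `ℤ[i]` is local to Mathlib's file). -/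
local notation "ℤ[i]" => GaussianInt

/-! ### `ℤ[i] ⊂ K1` -/

/-- In `K1 = ℚ(√-1)`: `ω² = -1`. [folklore] -/
theorem K1.omega_mul_omega : (ω : K1) * ω = ((-1 : ℤ) : K1) := by
  rw [omega_mul_omega_eq_mk]
  ext <;> simp

/-- **The inclusion `ℤ[i] →+* K1`**, `a + bi ↦ a + bω`. [folklore] -/
def toK1 : ℤ[i] →+* K1 := Zsqrtd.lift ⟨ω, K1.omega_mul_omega⟩

/-- `toK1 (a + bi) = a + b ω`. [folklore] -/
theorem toK1_apply (z : ℤ[i]) : toK1 z = (z.re : K1) + (z.im : K1) * ω := rfl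

/-- Real coordinate of `toK1 z`. [folklore] -/
@[simp] theorem toK1_re (z : ℤ[i]) : (toK1 z).re = z.re := by
  simp [toK1_apply, omega_re, omega_im]

/-- Imaginary coordinate of `toK1 z`. [folklore] -/
@[simp] theorem toK1_im (z : ℤ[i]) : (toK1 z).im = z.im := by
  simp [toK1_apply, omega_re, omega_im]

/-- `toK1 ⟨a, b⟩ = ⟨a, b⟩`. [folklore] -/
theorem toK1_mk (a b : ℤ) : toK1 ⟨a, b⟩ = (⟨(a : ℚ), (b : ℚ)⟩ : K1) := by
  ext <;> simp

/-- `toK1` is injective. [folklore] -/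
theorem toK1_injective : Function.Injective toK1 := fun z w h => by
  have hre := congrArg QuadraticAlgebra.re h
  have him := congrArg QuadraticAlgebra.im h
  simp only [toK1_re, toK1_im, Int.cast_inj] at hre him
  exact Zsqrtd.ext hre him

/-- `toK1 z = 0 ↔ z = 0`. [folklore] -/
theorem toK1_eq_zero_iff {z : ℤ[i]} : toK1 z = 0 ↔ z = 0 := by
  rw [← map_zero toK1]
  exact toK1_injective.eq_iff

/-- `toK1 z ≠ 0` for `z ≠ 0`. [folklore] -/
theorem toK1_ne_zero {z : ℤ[i]} (hz : z ≠ 0) : toK1 z ≠ 0 := fun h => hz (toK1_eq_zero_iff.mp h)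

/-- `toK1` on a natural number. [folklore] -/
theorem toK1_natCast (n : ℕ) : toK1 (n : ℤ[i]) = (n : K1) := map_natCast toK1 n

/-- `toK1` on an integer. [folklore] -/
theorem toK1_intCast (n : ℤ) : toK1 (n : ℤ[i]) = (n : K1) := map_intCast toK1 n

/-- **Clearing denominators**: every `x ∈ K1` is `toK1 z / N` for some Gaussian integer `z` and
some natural number `N ≥ 1`. [folklore] -/
theorem K1.exists_nat_mul_eq_toK1 (x : K1) :
    ∃ (z : ℤ[i]) (N : ℕ), 0 < N ∧ (N : K1) * x = toK1 z := by
  refine ⟨⟨x.re.num * x.im.den, x.im.num * x.re.den⟩, x.re.den * x.im.den,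
    Nat.mul_pos x.re.den_pos x.im.den_pos, ?_⟩
  have hre : (x.re.den : ℚ) * x.re = x.re.num := by
    rw [mul_comm]; exact Rat.mul_den_eq_num x.re
  have him : (x.im.den : ℚ) * x.im = x.im.num := by
    rw [mul_comm]; exact Rat.mul_den_eq_num x.im
  ext
  · rw [QuadraticAlgebra.re_mul, QuadraticAlgebra.re_natCast, QuadraticAlgebra.im_natCast,
      toK1_re]
    push_cast
    linear_combination (x.im.den : ℚ) * hre
  · rw [QuadraticAlgebra.im_mul, QuadraticAlgebra.re_natCast, QuadraticAlgebra.im_natCast,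
      toK1_im]
    push_cast
    linear_combination (x.re.den : ℚ) * him

/-- Variant: `x = toK1 z / N`. [folklore] -/
theorem K1.exists_eq_toK1_div_nat (x : K1) :
    ∃ (z : ℤ[i]) (N : ℕ), 0 < N ∧ x = toK1 z / (N : K1) := by
  obtain ⟨z, N, hN, h⟩ := K1.exists_nat_mul_eq_toK1 x
  refine ⟨z, N, hN, ?_⟩
  have hN' : (N : K1) ≠ 0 := Nat.cast_ne_zero.mpr hN.ne'
  rw [← h, mul_div_cancel_left₀ _ hN']

/-- `K1` as an algebra over the Gaussian integers, through `toK1`. [folklore] -/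
instance instAlgebraGaussianIntK1 : Algebra ℤ[i] K1 := toK1.toAlgebra

/-- The structure map `ℤ[i] → K1` is `toK1`. [folklore] -/
theorem algebraMap_gaussianInt_K1 : algebraMap ℤ[i] K1 = toK1 := rfl

/-- **`K1 = ℚ(√-1)` is the field of fractions of `ℤ[i]`.** [folklore] -/
instance instIsFractionRingGaussianIntK1 : IsFractionRing ℤ[i] K1 where
  map_units y := by
    rw [algebraMap_gaussianInt_K1]
    exact isUnit_iff_ne_zero.mpr (toK1_ne_zero (mem_nonZeroDivisors_iff_ne_zero.mp y.2))
  surj x := by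
    obtain ⟨z, N, hN, h⟩ := K1.exists_nat_mul_eq_toK1 x
    have hN0 : ((N : ℤ[i])) ≠ 0 := by exact_mod_cast hN.ne'
    refine ⟨(z, ⟨(N : ℤ[i]), mem_nonZeroDivisors_iff_ne_zero.mpr hN0⟩), ?_⟩
    change x * toK1 (N : ℤ[i]) = toK1 z
    rw [toK1_natCast, mul_comm, h]
  exists_of_eq h := ⟨1, by rw [toK1_injective h]⟩

/-! ### The prime elements -/

/-- The unit `i` of `ℤ[i]`. [folklore] -/
def gI : ℤ[i] := ⟨0, 1⟩
/-- The ramified prime `1 + i` of `ℤ[i]` above `2`. [folklore] -/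
def g2 : ℤ[i] := ⟨1, 1⟩
/-- The prime `2 + i` of `ℤ[i]` above `5`. [folklore] -/
def g5a : ℤ[i] := ⟨2, 1⟩
/-- The prime `2 - i` of `ℤ[i]` above `5`. [folklore] -/
def g5b : ℤ[i] := ⟨2, -1⟩
/-- The prime `5 + 4i` of `ℤ[i]` above `41`. [folklore] -/
def g41a : ℤ[i] := ⟨5, 4⟩
/-- The prime `5 - 4i` of `ℤ[i]` above `41`. [folklore] -/
def g41b : ℤ[i] := ⟨5, -4⟩
/-- The prime `8 + 3i` of `ℤ[i]` above `73`. [folklore] -/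
def g73a : ℤ[i] := ⟨8, 3⟩
/-- The prime `8 - 3i` of `ℤ[i]` above `73`. [folklore] -/
def g73b : ℤ[i] := ⟨8, -3⟩

/-- `i² = -1`. [folklore] -/
theorem gI_mul_gI : gI * gI = -1 := by decide

/-- `i` is a unit. [folklore] -/
theorem isUnit_gI : IsUnit gI :=
  ⟨⟨gI, -gI, by decide, by decide⟩, rfl⟩

/-- **A Gaussian integer of prime norm is prime** (irreducible by multiplicativity of the norm,
prime since `ℤ[i]` is a UFD). [folklore] -/
theorem prime_of_prime_natAbs_norm {z : ℤ[i]} (h : (Zsqrtd.norm z).natAbs.Prime) : Prime z := by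
  have hirr : Irreducible z := by
    refine ⟨fun hu => h.ne_one (Zsqrtd.norm_eq_one_iff.mpr hu), fun a b hab => ?_⟩
    have hn : (Zsqrtd.norm a).natAbs * (Zsqrtd.norm b).natAbs = (Zsqrtd.norm z).natAbs := by
      rw [hab, Zsqrtd.norm_mul, Int.natAbs_mul]
    rw [← hn] at h
    rcases Nat.prime_mul_iff.mp h with ⟨_, hb⟩ | ⟨_, ha⟩
    · exact Or.inr (Zsqrtd.norm_eq_one_iff.mp hb)
    · exact Or.inl (Zsqrtd.norm_eq_one_iff.mp ha)
  exact hirr.prime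

/-- `1 + i` is prime (norm `2`). [folklore] -/
theorem prime_g2 : Prime g2 := prime_of_prime_natAbs_norm (by norm_num [g2, Zsqrtd.norm_def])
/-- `2 + i` is prime (norm `5`). [folklore] -/
theorem prime_g5a : Prime g5a := prime_of_prime_natAbs_norm (by norm_num [g5a, Zsqrtd.norm_def])
/-- `2 - i` is prime (norm `5`). [folklore] -/
theorem prime_g5b : Prime g5b := prime_of_prime_natAbs_norm (by norm_num [g5b, Zsqrtd.norm_def])
/-- `5 + 4i` is prime (norm `41`). [folklore] -/
theorem prime_g41a : Prime g41a :=
  prime_of_prime_natAbs_norm (by norm_num [g41a, Zsqrtd.norm_def])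
/-- `5 - 4i` is prime (norm `41`). [folklore] -/
theorem prime_g41b : Prime g41b :=
  prime_of_prime_natAbs_norm (by norm_num [g41b, Zsqrtd.norm_def])
/-- `8 + 3i` is prime (norm `73`). [folklore] -/
theorem prime_g73a : Prime g73a :=
  prime_of_prime_natAbs_norm (by norm_num [g73a, Zsqrtd.norm_def])
/-- `8 - 3i` is prime (norm `73`). [folklore] -/
theorem prime_g73b : Prime g73b :=
  prime_of_prime_natAbs_norm (by norm_num [g73b, Zsqrtd.norm_def])

/-- `3` is prime in `ℤ[i]` (`3 ≡ 3 (mod 4)`, Mathlib). [folklore] -/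
theorem prime_three : Prime (3 : ℤ[i]) := by
  haveI : Fact (Nat.Prime 3) := ⟨Nat.prime_three⟩
  exact_mod_cast GaussianInt.prime_of_nat_prime_of_mod_four_eq_three 3 (by norm_num)

/-- The bad number `D = 2 · 3 · 5 · 41 · 73 = 89790` of the descents of the twists `E^{(d)}`, `d ∣ 41 · 73`, of `480a1` (conductor `2⁵·3·5`). [folklore] -/
def D : ℤ[i] := 89790

/-- **The factorisation of `D` in `ℤ[i]`**:
`89790 = -(i (1+i)²) · 3 · (2+i)(2-i) · (5+4i)(5-4i) · (8+3i)(8-3i)`. [folklore] -/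
theorem D_eq : D = -(gI * g2 ^ 2) * 3 * (g5a * g5b) * (g41a * g41b) * (g73a * g73b) := by decide

/-- Two primes of `ℤ[i]` one of which divides the other are associated. [folklore] -/
theorem associated_of_prime_dvd {p q : ℤ[i]} (hp : Prime p) (hq : Prime q) (h : p ∣ q) :
    Associated p q :=
  hp.associated_of_dvd hq h

/-- **A prime of `ℤ[i]` dividing `D = 2·3·5·41·73` is associated to one of
`1+i, 3, 2±i, 5±4i, 8±3i`.** [folklore] -/
theorem associated_of_prime_of_dvd_D {p : ℤ[i]} (hp : Prime p) (h : p ∣ D) :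
    Associated p g2 ∨ Associated p 3 ∨ Associated p g5a ∨ Associated p g5b ∨
      Associated p g41a ∨ Associated p g41b ∨ Associated p g73a ∨ Associated p g73b := by
  rw [D_eq] at h
  rcases hp.dvd_or_dvd h with h | h
  · rcases hp.dvd_or_dvd h with h | h
    · rcases hp.dvd_or_dvd h with h | h
      · rcases hp.dvd_or_dvd h with h | h
        · rw [dvd_neg] at h
          rcases hp.dvd_or_dvd h with h | h
          · exact absurd (isUnit_of_dvd_unit h isUnit_gI) hp.not_unit
          · exact Or.inl (associated_of_prime_dvd hp prime_g2 (hp.dvd_of_dvd_pow h))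
        · exact Or.inr (Or.inl (associated_of_prime_dvd hp prime_three h))
      · rcases hp.dvd_or_dvd h with h | h
        · exact Or.inr (Or.inr (Or.inl (associated_of_prime_dvd hp prime_g5a h)))
        · exact Or.inr (Or.inr (Or.inr (Or.inl (associated_of_prime_dvd hp prime_g5b h))))
    · rcases hp.dvd_or_dvd h with h | h
      · exact Or.inr (Or.inr (Or.inr (Or.inr (Or.inl (associated_of_prime_dvd hp prime_g41a h)))))
      · exact Or.inr (Or.inr (Or.inr (Or.inr (Or.inr (Or.inl
          (associated_of_prime_dvd hp prime_g41b h))))))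
  · rcases hp.dvd_or_dvd h with h | h
    · exact Or.inr (Or.inr (Or.inr (Or.inr (Or.inr (Or.inr (Or.inl
        (associated_of_prime_dvd hp prime_g73a h)))))))
    · exact Or.inr (Or.inr (Or.inr (Or.inr (Or.inr (Or.inr (Or.inr
        (associated_of_prime_dvd hp prime_g73b h)))))))

/-! ### Units -/

/-- **The units of `ℤ[i]` are `±1, ±i`.** [folklore] -/
theorem eq_of_isUnit {u : ℤ[i]} (hu : IsUnit u) : u = 1 ∨ u = -1 ∨ u = gI ∨ u = -gI := by
  have hn : u.norm = 1 := (Zsqrtd.norm_eq_one_iff' (by norm_num) u).mpr hu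
  rw [Zsqrtd.norm_def] at hn
  have hre : u.re * u.re ≤ 1 := by nlinarith [mul_self_nonneg u.im]
  have him : u.im * u.im ≤ 1 := by nlinarith [mul_self_nonneg u.re]
  have hre' : -1 ≤ u.re ∧ u.re ≤ 1 := by constructor <;> nlinarith
  have him' : -1 ≤ u.im ∧ u.im ≤ 1 := by constructor <;> nlinarith
  obtain ⟨a, b⟩ := u
  simp only at hn hre' him' ⊢
  obtain ⟨ha1, ha2⟩ := hre'
  obtain ⟨hb1, hb2⟩ := him'
  interval_cases a <;> interval_cases b <;> simp_all [gI, Zsqrtd.ext_iff]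

/-- **Every unit of `ℤ[i]` is `i^a · w²` with `a ∈ {0, 1}`** (`1 = 1²`, `-1 = i²`, `i = i·1²`,
`-i = i·i²`): the unit group modulo squares is `{1, i}`. [folklore] -/
theorem exists_eq_gI_pow_mul_sq_of_isUnit {u : ℤ[i]} (hu : IsUnit u) :
    ∃ (a : ℕ) (w : ℤ[i]), a < 2 ∧ IsUnit w ∧ u = gI ^ a * w ^ 2 := by
  rcases eq_of_isUnit hu with rfl | rfl | rfl | rfl
  · exact ⟨0, 1, by norm_num, isUnit_one, by decide⟩
  · exact ⟨0, gI, by norm_num, isUnit_gI, by decide⟩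
  · exact ⟨1, 1, by norm_num, isUnit_one, by decide⟩
  · exact ⟨1, gI, by norm_num, isUnit_gI, by decide⟩

/-- `i` is not divisible by any prime (it is a unit). [folklore] -/
theorem not_prime_dvd_gI {p : ℤ[i]} (hp : Prime p) : ¬ p ∣ gI := fun h =>
  hp.not_unit (isUnit_of_dvd_unit h isUnit_gI)

/-- The norms of the eight primes. [folklore] -/
theorem natAbs_norm_gens :
    (Zsqrtd.norm g2).natAbs = 2 ∧ (Zsqrtd.norm (3 : ℤ[i])).natAbs = 9 ∧
    (Zsqrtd.norm g5a).natAbs = 5 ∧ (Zsqrtd.norm g5b).natAbs = 5 ∧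
    (Zsqrtd.norm g41a).natAbs = 41 ∧ (Zsqrtd.norm g41b).natAbs = 41 ∧
    (Zsqrtd.norm g73a).natAbs = 73 ∧ (Zsqrtd.norm g73b).natAbs = 73 := by
  refine ⟨?_, ?_, ?_, ?_, ?_, ?_, ?_, ?_⟩ <;> decide

end Literature.Barriers.BirchSwinnertonDyer.DokchitserDokchitser2011
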